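import Literature.AlgebraicGeometry.Motives.HodgeThetaSubalgebraUnitaryFourteenFifteenCore
import HarnessLib

/-!
# The `Θ`-subalgebra theorem for unitary multiplicities `(10, 19)` — the last `p = 29` cell, closed classification-free
# by the inner rank bound «TOOL F» (Ribet 1983 Thm. 3, Lie step; abelian 29-folds of type `(10, 19)`)

Family `hodge`, layer `Literature/AlgebraicGeometry/Motives` (pure linear algebra over `ℂ`; no geometry). Research
context: cell `pub-hodge-ring2` (HONEST FRAMING: research route conditional on HC_CM; not a corollary; Q11.4-sentence-2
already refuted in dim ≥ 3), Literature lane gen 86, programme R74. UNCONDITIONAL; theorems only, no definition, no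
named fact (D-0026), no `sorry`.

THE PRINT. K. A. Ribet, Amer. J. Math. 105 (1983), Thm. 3 = Gordon's survey Thm. 6.3 (3) [held
`paper:arxiv-alg-geom_9709030` p. 18]: `End⁰ = k` imaginary quadratic acting with coprime multiplicities `(n′, n″)` ⟹
`Hg = U(V, φ)`, `B•(Xⁿ) = D•(Xⁿ)`. The lane replaces Ribet's appeal to the classification of minuscule representations
pair by pair. The cell `(10, 19)` had been recorded as «equivalent to the `(9 | 10)` cell» (README §HEIRS of gen 85/86);
it is not: the `(9 | 10)`-type Levi algebra it produces carries raising elements of CONSTANT RANK `8`, and constant rank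
`8` (unlike the constant rank `6` of the genuine `(9, 10)` cell) is excluded by a two-line inner rank bound.

* §1 **TOOL F `UnitaryConstantRank.false_of_le_rank`** — in the unitary setting, a raising `B` of rank `r` with
  `r < dim P` and `(dim P − r) + (dim Q − r) < r` cannot minimise the rank among the non-zero raising operators: a
  non-zero raising `X` commuting with the involution of `B` exists (`UnitaryLeviFull.exists_raise_commute_apply_ne_zero`)
  and has `rk X = rk X|_{U⁺} + rk X|_{U⁻} ≤ (dim P − r) + (dim Q − r) < r` (`UnitaryLeviSetup.exists_levi_pair`).
* §2 **`UnitaryTenNineteen.eq_top_of_smul`.** Ranks `1, …, 8` are good (larger-side Levi types `(1|18)`, `(2|17)`,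
  `(3|16)`, `(4|15)`, `(5|14)`, `(6|13)`, `(7|12)`, `(8|11)` are tree cores), so if `𝔊 ≠ End(W)` then `S ⊆ {0, 9, 10}`.
  (G1) `10 ∉ S`: at `r = 10`, `U⁺ = C(P)` has no `P`-part, so every raising `X` commuting with `ι` has `rk X = rk X|_{U⁻}
  ∈ {0, 9}`; `9` is killed by the mirrored inner double Levi in `L⁻` of type `(10|9)` (core `(9|1)`,
  `UnitaryDoubleLevi.eq_top_of_raise_of_core'`, then `UnitaryLeviSetup.false_of_full_larger`), and `0` for all `X`
  contradicts `exists_raise_commute_apply_ne_zero` for `−ι`. (G2) `S = {0, 9}`: at `r = 9`, `U⁺` of type `(1|9)`, `U⁻`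
  of type `(9|10)`; `j = 9` is killed by the core `(9|1)` inside `L⁻`, so the profiles are `(0,0)` and `(1,8)`: the
  raising elements of `L⁻` have constant rank `8`, and TOOL F applies inside `L⁻` (`(9 − 8) + (10 − 8) = 3 < 8`).
  **`eq_top_of_smul'`** is the mirror `(19, 10)`.

CONSEQUENCES (sequel under `HodgeTheory/`): Ribet's theorem at `(n′, n″) = (10, 19)`; with the `(14 | 15)` core, EVERY
simple complex abelian `29`-fold with `End⁰ ≠ ℚ` satisfies `B• = D•` on all powers.

## References
* [Ribet1983] K. A. Ribet, *Hodge classes on certain types of abelian varieties*, Amer. J. Math. 105 (1983), Thm. 3.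
* [Gordon1997] B. B. Gordon, *A survey of the Hodge conjecture for abelian varieties*, Thm. 6.3 (3), pp. 18–19.
* [Deligne1982HodgeCycles] P. Deligne, *Hodge cycles on abelian varieties*, LNM 900 (1982), I §3 Prop. 3.4, 3.6.
* [GoodmanWallachGTM255] R. Goodman, N. R. Wallach, GTM 255 (2009), §4.1.1.
* [HoffmanKunze1971LinearAlgebra] K. Hoffman, R. Kunze, *Linear Algebra* (1971), §3.1 Thm. 2, §6.7, §8.3.
-/

noncomputable section

open Module

namespace Literature.AlgebraicGeometry.Motives

namespace HodgeStructure

universe u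

variable {W : Type u} [AddCommGroup W] [Module ℂ W]

/-! ### §1 TOOL F: the inner rank bound -/

/-- **TOOL F — the inner rank bound.** In the unitary setting, let `B ∈ 𝔊` be raising of rank `r < dim P` with
`(dim P − r) + (dim Q − r) < r`. Then `B` does not minimise the rank among non-zero raising operators: it is false that
every non-zero raising `X ∈ 𝔊` has `rk X ≥ r`. (A non-zero raising `X` commuting with the involution of `B` exists and
has `rk X = rk X|_{U⁺} + rk X|_{U⁻} ≤ (dim P − r) + (dim Q − r)`.) [cite: Ribet1983, Thm. 3]
[cite: GoodmanWallachGTM255, §4.1.1] [cite: HoffmanKunze1971LinearAlgebra, §3.1 Thm. 2] -/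
theorem UnitaryConstantRank.false_of_le_rank [FiniteDimensional ℂ W] {𝔊 : Submodule ℂ (Module.End ℂ W)}
    (hbr : ∀ Y ∈ 𝔊, ∀ Z ∈ 𝔊, Y * Z - Z * Y ∈ 𝔊)
    (hirr : ∀ U : Submodule ℂ W, (∀ A ∈ 𝔊, ∀ u ∈ U, A u ∈ U) → U = ⊥ ∨ U = ⊤)
    {Θ : Module.End ℂ W} (hΘ : Θ ∈ 𝔊) (hΘΘ : Θ * Θ = 1)
    {P Q : Submodule ℂ W} (hP : ∀ x, x ∈ P ↔ Θ x = x) (hQ : ∀ x, x ∈ Q ↔ Θ x = -x)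
    {s : W → W → ℂ} (hadd : ∀ x y z, s (x + y) z = s x z + s y z) (hsymm : ∀ x y, s y x = starRingEnd ℂ (s x y))
    (hPQ : ∀ p ∈ P, ∀ q ∈ Q, s p q = 0) (hdefP : ∀ p ∈ P, s p p = 0 → p = 0) (hdefQ : ∀ q ∈ Q, s q q = 0 → q = 0)
    (hadj : ∀ X ∈ 𝔊, ∃ Y ∈ 𝔊, ∀ x y, s (X x) y = s x (Y y))
    {B : Module.End ℂ W} (hB : B ∈ 𝔊) (hΘB : Θ * B = B) (hBΘ : B * Θ = -B)
    (hrP : Module.finrank ℂ (LinearMap.range B) < Module.finrank ℂ P)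
    (hlt : (Module.finrank ℂ P - Module.finrank ℂ (LinearMap.range B)) +
      (Module.finrank ℂ Q - Module.finrank ℂ (LinearMap.range B)) < Module.finrank ℂ (LinearMap.range B))
    (hmin : ∀ X ∈ 𝔊, Θ * X = X → X * Θ = -X → X ≠ 0 →
      Module.finrank ℂ (LinearMap.range B) ≤ Module.finrank ℂ (LinearMap.range X)) : False := by
  classical
  obtain ⟨ι, Um, Up, PU, QU, Lm, ιm, Pm, Qm, Lp, ιp, Pp, Qp, hιmem, hιι, hιΘ, hιs, hUm, hUp, hfinUm, hfinUp,
    hPM, hQM, hPU, hQU, hrangeP, hPUP, hQUQ, hfinQM, hfinPU, hfinQU, hLm, hLp,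
    hιmapply, hPmmem, hQmmem, hbrLm, hirrLm, hιmmem, hιmιm, hPm, hQm, hfinPm, hfinQm, hPmQm, hdefPm, hdefQm, hadjLm,
    hιpapply, hPpmem, hQpmem, hbrLp, hirrLp, hιpmem, hιpιp, hPp, hQp, hfinPp, hfinQp, hPpQp, hdefPp, hdefQp, hadjLp,
    hsplit⟩ :=
    UnitaryLeviSetup.exists_levi_pair hbr hirr hΘ hΘΘ hP hQ hadd hsymm hPQ hdefP hdefQ hadj hB hΘB hBΘ
  obtain ⟨⟨p, hp⟩, hp0⟩ := Module.finrank_pos_iff_exists_ne_zero.1 (show 0 < Module.finrank ℂ PU by omega)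
  obtain ⟨⟨q, hq⟩, hq0⟩ := Module.finrank_pos_iff_exists_ne_zero.1 (show 0 < Module.finrank ℂ QU by omega)
  obtain ⟨X₀, hX₀, hΘX₀, hX₀Θ, hX₀c, c, hιc, hΘc, hX₀c0⟩ :=
    UnitaryLeviFull.exists_raise_commute_apply_ne_zero hbr hirr hΘ hΘΘ hQ hιmem hιι hιΘ hUm hUp
      ⟨p, fun h => hp0 (Subtype.ext h), ((hPU p).1 hp).1, ((hPU p).1 hp).2⟩
      ⟨q, fun h => hq0 (Subtype.ext h), ((hQU q).1 hq).1, ((hQU q).1 hq).2⟩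
  have hX₀ne : X₀ ≠ 0 := fun h => hX₀c0 (by rw [h, LinearMap.zero_apply])
  obtain ⟨hs, hi, -, -, hj⟩ := hsplit X₀ hΘX₀ hX₀Θ hX₀c
  have hr := hmin X₀ hX₀ hΘX₀ hX₀Θ hX₀ne
  omega

/-! ### §2 The two steps and the `(10 | 19)` core -/

/-- (G1) If every raising operator has rank in `{0, 9, 10}`, none has rank `10` (module docstring).
[cite: Ribet1983, Thm. 3] [cite: Gordon1997, Thm. 6.3 (3)] [cite: GoodmanWallachGTM255, §4.1.1] -/
theorem UnitaryTenNineteen.no_rank_ten [FiniteDimensional ℂ W] {𝔊 : Submodule ℂ (Module.End ℂ W)}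
    (hbr : ∀ Y ∈ 𝔊, ∀ Z ∈ 𝔊, Y * Z - Z * Y ∈ 𝔊)
    (hirr : ∀ U : Submodule ℂ W, (∀ A ∈ 𝔊, ∀ u ∈ U, A u ∈ U) → U = ⊥ ∨ U = ⊤)
    {Θ : Module.End ℂ W} (hΘ : Θ ∈ 𝔊) (hΘΘ : Θ * Θ = 1)
    {P Q : Submodule ℂ W} (hP : ∀ x, x ∈ P ↔ Θ x = x) (hQ : ∀ x, x ∈ Q ↔ Θ x = -x)
    (hP10 : Module.finrank ℂ P = 10) (hQ19 : Module.finrank ℂ Q = 19)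
    {s : W → W → ℂ} (hadd : ∀ x y z, s (x + y) z = s x z + s y z)
    (hsymm : ∀ x y, s y x = starRingEnd ℂ (s x y))
    (hPQ : ∀ p ∈ P, ∀ q ∈ Q, s p q = 0) (hdefP : ∀ p ∈ P, s p p = 0 → p = 0) (hdefQ : ∀ q ∈ Q, s q q = 0 → q = 0)
    (hadj : ∀ X ∈ 𝔊, ∃ Y ∈ 𝔊, ∀ x y, s (X x) y = s x (Y y))
    (hS : ∀ B' ∈ 𝔊, Θ * B' = B' → B' * Θ = -B' →
      Module.finrank ℂ (LinearMap.range B') = 0 ∨ Module.finrank ℂ (LinearMap.range B') = 9 ∨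
        Module.finrank ℂ (LinearMap.range B') = 10)
    {B : Module.End ℂ W} (hB : B ∈ 𝔊) (hΘB : Θ * B = B) (hBΘ : B * Θ = -B)
    (h10 : Module.finrank ℂ (LinearMap.range B) = 10) : False := by
  classical
  have hsU : ∀ U : Submodule ℂ W, ∀ x y z : U, s ((x + y : U) : W) z = s (x : W) z + s (y : W) z :=
    fun U x y z => by simp only [Submodule.coe_add, hadd]
  have hno1 : ∀ B' ∈ 𝔊, Θ * B' = B' → B' * Θ = -B' → Module.finrank ℂ (LinearMap.range B') ≠ 1 := by
    intro B' hB' hΘB' hB'Θ h1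
    rcases hS B' hB' hΘB' hB'Θ with h | h | h <;> omega
  obtain ⟨ι, Um, Up, PU, QU, Lm, ιm, Pm, Qm, Lp, ιp, Pp, Qp, hιmem, hιι, hιΘ, hιs, hUm, hUp, hfinUm, hfinUp,
    hPM, hQM, hPU, hQU, hrangeP, hPUP, hQUQ, hfinQM, hfinPU, hfinQU, hLm, hLp,
    hιmapply, hPmmem, hQmmem, hbrLm, hirrLm, hιmmem, hιmιm, hPm, hQm, hfinPm, hfinQm, hPmQm, hdefPm, hdefQm, hadjLm,
    hιpapply, hPpmem, hQpmem, hbrLp, hirrLp, hιpmem, hιpιp, hPp, hQp, hfinPp, hfinQp, hPpQp, hdefPp, hdefQp, hadjLp,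
    hsplit⟩ :=
    UnitaryLeviSetup.exists_levi_pair hbr hirr hΘ hΘΘ hP hQ hadd hsymm hPQ hdefP hdefQ hadj hB hΘB hBΘ
  rw [h10] at hfinQM hfinPU hfinQU hfinPm hfinQm hfinPp hfinQp hsplit
  rw [hQ19] at hfinQM hfinQm hfinUm
  rw [hP10] at hfinPU hfinPp hfinUp
  have hcm : ∀ Z : Module.End ℂ W, Z * ι = ι * Z → ∀ x ∈ Um, Z x ∈ Um := fun Z hZ x hx =>
    (hUm _).2 (by rw [← Module.End.mul_apply, ← hZ, Module.End.mul_apply, (hUm x).1 hx, map_neg])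
  have hfullm_of : Lm = ⊤ → False := fun h =>
    UnitaryLeviSetup.false_of_full_larger hbr hΘΘ hno1 hιι hιΘ hUm hUp (by omega) (by omega) hPM hQM (by omega)
      (by omega) hLm h
  -- `j ≠ 9`: the mirrored inner double Levi in `L⁻` (type `(10 | 9)`), core `(9 | 1)`
  have hkillm9 : ∀ X ∈ 𝔊, Θ * X = X → X * Θ = -X → X * ι = ι * X → Module.finrank ℂ (Um.map X) ≠ 9 := by
    intro X hX hΘX hXΘ hXc h9
    obtain ⟨hxmem, hιmx, hxιm, hxrk⟩ := UnitaryLeviSetup.restrict_mem hcm hLm hιmapply X hX hΘX hXΘ hXc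
    rw [h9] at hxrk
    refine hfullm_of (UnitaryDoubleLevi.eq_top_of_raise_of_core' hbrLm hirrLm hιmmem hιmιm hPm hQm
      (s := fun v w : Um => s (v : W) w) (hsU Um) (fun v w => hsymm v w) hPmQm hdefPm hdefQm hadjLm hxmem hιmx hxιm
      (by rw [hxrk]; norm_num) (by omega) (by omega)
      fun U' 𝔩' ι' P' Q' hbr𝔩' hirr𝔩' hι' hι'ι' hP' hQ' hfinP' hfinQ' _ _ _ _ => ?_)
    rw [hxrk] at hfinP' hfinQ'
    rw [hfinPm] at hfinQ'
    exact UnitaryThreeCoprime.eq_top_of_finrank_eq_one hbr𝔩' hirr𝔩' hι' hι'ι' hP' hQ' (by omega) (by omega)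
  -- hence every raising `X` commuting with `ι` vanishes on `U⁻` (and on `U⁺ = C(P)`)
  have hj0 : ∀ X ∈ 𝔊, Θ * X = X → X * Θ = -X → X * ι = ι * X → Module.finrank ℂ (Um.map X) = 0 := by
    intro X hX hΘX hXΘ hXc
    obtain ⟨hs, hi, -, -, hj⟩ := hsplit X hΘX hXΘ hXc
    have h9 := hkillm9 X hX hΘX hXΘ hXc
    have hr := hS X hX hΘX hXΘ
    rw [hs] at hr
    omega
  -- but some raising `Y` commuting with `ι` moves `U⁻ ∩ Q`
  have hnι : -ι ∈ 𝔊 := Submodule.neg_mem _ hιmem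
  have hnιι : (-ι) * (-ι) = 1 := by rw [neg_mul_neg, hιι]
  have hnιΘ : (-ι) * Θ = Θ * (-ι) := by rw [neg_mul, mul_neg, hιΘ]
  have hUm' : ∀ x, x ∈ Um ↔ (-ι) x = x := fun x => by rw [hUm, LinearMap.neg_apply, neg_eq_iff_eq_neg]
  have hUp' : ∀ x, x ∈ Up ↔ (-ι) x = -x := fun x => by rw [hUp, LinearMap.neg_apply, neg_inj]
  obtain ⟨⟨u, hu⟩, hu0⟩ := Module.finrank_pos_iff_exists_ne_zero.1
    (show 0 < Module.finrank ℂ (LinearMap.range B) by omega)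
  obtain ⟨⟨d₀, hd₀⟩, hd₀0⟩ := Module.finrank_pos_iff_exists_ne_zero.1
    (show 0 < Module.finrank ℂ ↥(Q ⊓ LinearMap.ker B) by omega)
  obtain ⟨Y, hY, hΘY, hYΘ, hYc', d, hιd, hΘd, hYd⟩ :=
    UnitaryLeviFull.exists_raise_commute_apply_ne_zero hbr hirr hΘ hΘΘ hQ hnι hnιι hnιΘ hUp' hUm'
      ⟨u, fun h => hu0 (Subtype.ext h), by rw [LinearMap.neg_apply, ((hPM u).1 hu).1, neg_neg], ((hPM u).1 hu).2⟩
      ⟨d₀, fun h => hd₀0 (Subtype.ext h), by rw [LinearMap.neg_apply, ((hQM d₀).1 hd₀).1, neg_neg], ((hQM d₀).1 hd₀).2⟩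
  have hYc : Y * ι = ι * Y := by rw [mul_neg, neg_mul, neg_inj] at hYc'; exact hYc'
  have h0 := hj0 Y hY hΘY hYΘ hYc
  have hmem : Y d ∈ Um.map Y := Submodule.mem_map_of_mem ((hUm' d).2 hιd)
  rw [Submodule.finrank_eq_zero.1 h0, Submodule.mem_bot] at hmem
  exact hYd hmem

/-- (G2) The raising ranks cannot all lie in `{0, 9}`: at a rank-`9` base point the Levi algebra `L⁻` of type `(9 | 10)`
would have constant raising rank `8`, excluded by TOOL F (module docstring). [cite: Ribet1983, Thm. 3]
[cite: Gordon1997, Thm. 6.3 (3)] [cite: GoodmanWallachGTM255, §4.1.1] -/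
theorem UnitaryTenNineteen.false_of_rank_zero_or_nine [FiniteDimensional ℂ W] {𝔊 : Submodule ℂ (Module.End ℂ W)}
    (hbr : ∀ Y ∈ 𝔊, ∀ Z ∈ 𝔊, Y * Z - Z * Y ∈ 𝔊)
    (hirr : ∀ U : Submodule ℂ W, (∀ A ∈ 𝔊, ∀ u ∈ U, A u ∈ U) → U = ⊥ ∨ U = ⊤)
    {Θ : Module.End ℂ W} (hΘ : Θ ∈ 𝔊) (hΘΘ : Θ * Θ = 1)
    {P Q : Submodule ℂ W} (hP : ∀ x, x ∈ P ↔ Θ x = x) (hQ : ∀ x, x ∈ Q ↔ Θ x = -x)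
    (hP10 : Module.finrank ℂ P = 10) (hQ19 : Module.finrank ℂ Q = 19)
    {s : W → W → ℂ} (hadd : ∀ x y z, s (x + y) z = s x z + s y z)
    (hsymm : ∀ x y, s y x = starRingEnd ℂ (s x y))
    (hPQ : ∀ p ∈ P, ∀ q ∈ Q, s p q = 0) (hdefP : ∀ p ∈ P, s p p = 0 → p = 0) (hdefQ : ∀ q ∈ Q, s q q = 0 → q = 0)
    (hadj : ∀ X ∈ 𝔊, ∃ Y ∈ 𝔊, ∀ x y, s (X x) y = s x (Y y))
    (hS : ∀ B' ∈ 𝔊, Θ * B' = B' → B' * Θ = -B' →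
      Module.finrank ℂ (LinearMap.range B') = 0 ∨ Module.finrank ℂ (LinearMap.range B') = 9) : False := by
  classical
  have hsU : ∀ U : Submodule ℂ W, ∀ x y z : U, s ((x + y : U) : W) z = s (x : W) z + s (y : W) z :=
    fun U x y z => by simp only [Submodule.coe_add, hadd]
  have hno1 : ∀ B' ∈ 𝔊, Θ * B' = B' → B' * Θ = -B' → Module.finrank ℂ (LinearMap.range B') ≠ 1 := by
    intro B' hB' hΘB' hB'Θ h1
    rcases hS B' hB' hΘB' hB'Θ with h | h <;> omega
  -- a raising operator of rank `9`
  obtain ⟨B, hB, hΘB, hBΘ, hr2⟩ :=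
    UnitaryThreeCoprime.exists_raise_rank_ge_two hbr hirr hΘ hΘΘ hP hQ (by omega) (by omega)
  have h9 : Module.finrank ℂ (LinearMap.range B) = 9 := by
    rcases hS B hB hΘB hBΘ with h | h <;> omega
  obtain ⟨ι, Um, Up, PU, QU, Lm, ιm, Pm, Qm, Lp, ιp, Pp, Qp, hιmem, hιι, hιΘ, hιs, hUm, hUp, hfinUm, hfinUp,
    hPM, hQM, hPU, hQU, hrangeP, hPUP, hQUQ, hfinQM, hfinPU, hfinQU, hLm, hLp,
    hιmapply, hPmmem, hQmmem, hbrLm, hirrLm, hιmmem, hιmιm, hPm, hQm, hfinPm, hfinQm, hPmQm, hdefPm, hdefQm, hadjLm,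
    hιpapply, hPpmem, hQpmem, hbrLp, hirrLp, hιpmem, hιpιp, hPp, hQp, hfinPp, hfinQp, hPpQp, hdefPp, hdefQp, hadjLp,
    hsplit⟩ :=
    UnitaryLeviSetup.exists_levi_pair hbr hirr hΘ hΘΘ hP hQ hadd hsymm hPQ hdefP hdefQ hadj hB hΘB hBΘ
  rw [h9] at hfinQM hfinPU hfinQU hfinPm hfinQm hfinPp hfinQp hsplit
  rw [hQ19] at hfinQM hfinQm hfinUm
  rw [hP10] at hfinPU hfinPp hfinUp
  have hcm : ∀ Z : Module.End ℂ W, Z * ι = ι * Z → ∀ x ∈ Um, Z x ∈ Um := fun Z hZ x hx =>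
    (hUm _).2 (by rw [← Module.End.mul_apply, ← hZ, Module.End.mul_apply, (hUm x).1 hx, map_neg])
  have hfullm_of : Lm = ⊤ → False := fun h =>
    UnitaryLeviSetup.false_of_full_larger hbr hΘΘ hno1 hιι hιΘ hUm hUp (by omega) (by omega) hPM hQM (by omega)
      (by omega) hLm h
  -- `j ≠ 9`: the core `(9 | 1)` inside `L⁻` (type `(9 | 10)`)
  have hkillm9 : ∀ X ∈ 𝔊, Θ * X = X → X * Θ = -X → X * ι = ι * X → Module.finrank ℂ (Um.map X) ≠ 9 := by
    intro X hX hΘX hXΘ hXc hj9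
    obtain ⟨hxmem, hιmx, hxιm, hxrk⟩ := UnitaryLeviSetup.restrict_mem hcm hLm hιmapply X hX hΘX hXΘ hXc
    rw [hj9] at hxrk
    refine hfullm_of (UnitaryDoubleLevi.eq_top_of_raise_of_core hbrLm hirrLm hιmmem hιmιm hPm hQm
      (s := fun v w : Um => s (v : W) w) (hsU Um) (fun v w => hsymm v w) hPmQm hdefPm hdefQm hadjLm hxmem hιmx hxιm
      (by rw [hxrk]; norm_num) (by omega) (by omega)
      fun U' 𝔩' ι' P' Q' hbr𝔩' hirr𝔩' hι' hι'ι' hP' hQ' hfinP' hfinQ' _ _ _ _ => ?_)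
    rw [hxrk] at hfinP' hfinQ'
    exact UnitaryThreeCoprime.eq_top_of_finrank_eq_one hbr𝔩' hirr𝔩' hι' hι'ι' hP' hQ' (by omega) (by omega)
  -- the profiles are `(0, 0)` and `(1, 8)`
  have hprof : ∀ X ∈ 𝔊, Θ * X = X → X * Θ = -X → X * ι = ι * X →
      (Module.finrank ℂ (Up.map X) = 0 ∧ Module.finrank ℂ (Um.map X) = 0) ∨
        (Module.finrank ℂ (Up.map X) = 1 ∧ Module.finrank ℂ (Um.map X) = 8) := by
    intro X hX hΘX hXΘ hXc
    obtain ⟨hs, hi, -, -, hj⟩ := hsplit X hΘX hXΘ hXc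
    have hj9 := hkillm9 X hX hΘX hXΘ hXc
    have hr := hS X hX hΘX hXΘ
    rw [hs] at hr
    omega
  -- some `X₀` has profile `(1, 8)`; its restriction to `U⁻` is a rank-`8` raising element of `L⁻`
  obtain ⟨⟨p, hp⟩, hp0⟩ := Module.finrank_pos_iff_exists_ne_zero.1 (show 0 < Module.finrank ℂ PU by omega)
  obtain ⟨⟨q, hq⟩, hq0⟩ := Module.finrank_pos_iff_exists_ne_zero.1 (show 0 < Module.finrank ℂ QU by omega)
  obtain ⟨X₀, hX₀, hΘX₀, hX₀Θ, hX₀c, c, hιc, hΘc, hX₀c0⟩ :=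
    UnitaryLeviFull.exists_raise_commute_apply_ne_zero hbr hirr hΘ hΘΘ hQ hιmem hιι hιΘ hUm hUp
      ⟨p, fun h => hp0 (Subtype.ext h), ((hPU p).1 hp).1, ((hPU p).1 hp).2⟩
      ⟨q, fun h => hq0 (Subtype.ext h), ((hQU q).1 hq).1, ((hQU q).1 hq).2⟩
  have hX₀j : Module.finrank ℂ (Um.map X₀) = 8 := by
    rcases hprof X₀ hX₀ hΘX₀ hX₀Θ hX₀c with ⟨hi0, -⟩ | ⟨-, hj8⟩
    · exfalso
      have hmem : X₀ c ∈ Up.map X₀ := Submodule.mem_map_of_mem ((hUp c).2 hιc)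
      rw [Submodule.finrank_eq_zero.1 hi0, Submodule.mem_bot] at hmem
      exact hX₀c0 hmem
    · exact hj8
  obtain ⟨hxmem, hιmx, hxιm, hxrk⟩ := UnitaryLeviSetup.restrict_mem hcm hLm hιmapply X₀ hX₀ hΘX₀ hX₀Θ hX₀c
  rw [hX₀j] at hxrk
  -- TOOL F inside `L⁻`: constant rank `8` on type `(9 | 10)` is impossible
  refine UnitaryConstantRank.false_of_le_rank hbrLm hirrLm hιmmem hιmιm hPm hQm (s := fun v w : Um => s (v : W) w)
    (hsU Um) (fun v w => hsymm v w) hPmQm hdefPm hdefQm hadjLm hxmem hιmx hxιm (by rw [hxrk]; omega)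
    (by rw [hxrk]; omega) fun A hA hιA hAι hAne => ?_
  obtain ⟨X, hX, hΘX, hXΘ, hXc, hXUm⟩ := UnitaryLeviSetup.exists_lift hbr hΘ hΘΘ hcm hιΘ hLm hιmapply A hA hιA hAι
  rcases hprof X hX hΘX hXΘ hXc with ⟨-, hj0⟩ | ⟨-, hj8⟩
  · exfalso
    rw [hj0] at hXUm
    exact hAne (LinearMap.range_eq_bot.1 (Submodule.finrank_eq_zero.1 hXUm.symm))
  · rw [hxrk, ← hXUm, hj8]

/-- **THE `Θ`-SUBALGEBRA THEOREM FOR UNITARY MULTIPLICITIES `(10, 19)` — complex Hermitian core, classification-free.**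
`𝔊 ⊆ End(W)` bracket-closed and irreducible, `Θ ∈ 𝔊` an involution with `dim P = 10`, `dim Q = 19`, Hermitian data
(`s` additive and `ℂ`-homogeneous in the first slot, Hermitian-symmetric, `P ⊥ Q`, definite on `P` and on `Q`), `𝔊`
adjoint-closed ⟹ `𝔊 = End(W)`. See the module docstring. [cite: Ribet1983, Thm. 3] [cite: Gordon1997, Thm. 6.3 (3)]
[cite: Deligne1982HodgeCycles, I §3 Prop. 3.4, 3.6] [cite: GoodmanWallachGTM255, §4.1.1] -/
theorem UnitaryTenNineteen.eq_top_of_smul [FiniteDimensional ℂ W] {𝔊 : Submodule ℂ (Module.End ℂ W)}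
    (hbr : ∀ Y ∈ 𝔊, ∀ Z ∈ 𝔊, Y * Z - Z * Y ∈ 𝔊)
    (hirr : ∀ U : Submodule ℂ W, (∀ A ∈ 𝔊, ∀ u ∈ U, A u ∈ U) → U = ⊥ ∨ U = ⊤)
    {Θ : Module.End ℂ W} (hΘ : Θ ∈ 𝔊) (hΘΘ : Θ * Θ = 1)
    {P Q : Submodule ℂ W} (hP : ∀ x, x ∈ P ↔ Θ x = x) (hQ : ∀ x, x ∈ Q ↔ Θ x = -x)
    (hP10 : Module.finrank ℂ P = 10) (hQ19 : Module.finrank ℂ Q = 19)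
    {s : W → W → ℂ} (hadd : ∀ x y z, s (x + y) z = s x z + s y z)
    (hsmul : ∀ (c : ℂ) (x y : W), s (c • x) y = c * s x y) (hsymm : ∀ x y, s y x = starRingEnd ℂ (s x y))
    (hPQ : ∀ p ∈ P, ∀ q ∈ Q, s p q = 0) (hdefP : ∀ p ∈ P, s p p = 0 → p = 0) (hdefQ : ∀ q ∈ Q, s q q = 0 → q = 0)
    (hadj : ∀ X ∈ 𝔊, ∃ Y ∈ 𝔊, ∀ x y, s (X x) y = s x (Y y)) : 𝔊 = ⊤ := by
  classical
  have hraiseval : ∀ Z : Module.End ℂ W, Θ * Z = Z → ∀ w, Z w ∈ P := fun Z hΘZ w =>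
    (hP _).2 (by rw [← Module.End.mul_apply, hΘZ])
  have hle10 : ∀ B' : Module.End ℂ W, Θ * B' = B' → Module.finrank ℂ (LinearMap.range B') ≤ 10 := fun B' h => by
    rw [← hP10]
    exact Submodule.finrank_mono (by rintro _ ⟨w, rfl⟩; exact hraiseval B' h w)
  have hsU : ∀ U : Submodule ℂ W, ∀ x y z : U, s ((x + y : U) : W) z = s (x : W) z + s (y : W) z :=
    fun U x y z => by simp only [Submodule.coe_add, hadd]
  have hsmU : ∀ U : Submodule ℂ W, ∀ (c : ℂ) (x y : U), s ((c • x : U) : W) y = c * s (x : W) y :=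
    fun U c x y => by simp only [Submodule.coe_smul, hsmul]
  -- STEP 1: the good ranks `1, …, 8`
  have key : ∀ B' ∈ 𝔊, Θ * B' = B' → B' * Θ = -B' → 1 ≤ Module.finrank ℂ (LinearMap.range B') →
      Module.finrank ℂ (LinearMap.range B') ≤ 8 → 𝔊 = ⊤ := by
    intro B' hB' hΘB' hB'Θ hr1 hr8
    refine UnitaryDoubleLevi.eq_top_of_raise_of_core hbr hirr hΘ hΘΘ hP hQ hadd hsymm hPQ hdefP hdefQ hadj hB' hΘB' hB'Θ
      (by omega) (by omega) (by omega)
      fun U 𝔩 ι P' Q' hbr𝔩 hirr𝔩 hι hιι hP' hQ' hfinP' hfinQ' hP'Q' hdefP' hdefQ' hadj𝔩 => ?_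
    rw [hQ19] at hfinQ'
    have hr : Module.finrank ℂ (LinearMap.range B') = 1 ∨ Module.finrank ℂ (LinearMap.range B') = 2 ∨
        Module.finrank ℂ (LinearMap.range B') = 3 ∨ Module.finrank ℂ (LinearMap.range B') = 4 ∨
        Module.finrank ℂ (LinearMap.range B') = 5 ∨ Module.finrank ℂ (LinearMap.range B') = 6 ∨
        Module.finrank ℂ (LinearMap.range B') = 7 ∨ Module.finrank ℂ (LinearMap.range B') = 8 := by omega
    rcases hr with h | h | h | h | h | h | h | h <;> rw [h] at hfinP' hfinQ'
    · -- `(1 | 18)`: the `(m, 1)` core for `−ι`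
      exact UnitaryThreeCoprime.eq_top_of_finrank_eq_one hbr𝔩 hirr𝔩 (Submodule.neg_mem _ hι)
        ((neg_mul_neg ι ι).trans hιι) (P := Q') (Q := P') (fun x => by rw [hQ', LinearMap.neg_apply, neg_eq_iff_eq_neg])
        (fun x => by rw [hP', LinearMap.neg_apply, neg_inj]) (by omega) hfinP'
    · -- `(2 | 17)`
      exact UnitaryTwoOdd.eq_top hbr𝔩 hirr𝔩 hι hιι hP' hQ' hfinP' ⟨8, by omega⟩ (s := fun x y : U => s (x : W) y)
        (hsU U) (fun x y => hsymm x y) hP'Q' hdefP' hdefQ' hadj𝔩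
    · -- `(3 | 16)`
      exact UnitaryThreeCoprime.eq_top hbr𝔩 hirr𝔩 hι hιι hP' hQ' hfinP' (by omega) (s := fun x y : U => s (x : W) y)
        (hsU U) (fun x y => hsymm x y) hP'Q' hdefP' hdefQ' hadj𝔩
    · -- `(4 | 15)`
      exact UnitaryFourOdd.eq_top hbr𝔩 hirr𝔩 hι hιι hP' hQ' hfinP' ⟨7, by omega⟩ (s := fun x y : U => s (x : W) y)
        (hsU U) (fun x y => hsymm x y) hP'Q' hdefP' hdefQ' hadj𝔩
    · -- `(5 | 14)`
      exact UnitaryFive.eq_top hbr𝔩 hirr𝔩 hι hιι hP' hQ' hfinP' (Or.inr (by omega)) (s := fun x y : U => s (x : W) y)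
        (hsU U) (fun x y => hsymm x y) hP'Q' hdefP' hdefQ' hadj𝔩
    · -- `(6 | 13)`
      exact UnitarySix.eq_top_of_smul hbr𝔩 hirr𝔩 hι hιι hP' hQ' hfinP' ⟨6, by omega⟩ (by omega)
        (s := fun x y : U => s (x : W) y) (hsU U) (hsmU U) (fun x y => hsymm x y) hP'Q' hdefP' hdefQ' hadj𝔩
    · -- `(7 | 12)`
      exact UnitarySeven.eq_top_of_smul hbr𝔩 hirr𝔩 hι hιι hP' hQ' hfinP' (by omega) (s := fun x y : U => s (x : W) y)
        (hsU U) (hsmU U) (fun x y => hsymm x y) hP'Q' hdefP' hdefQ' hadj𝔩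
    · -- `(8 | 11)`
      exact UnitaryEight.eq_top_of_smul hbr𝔩 hirr𝔩 hι hιι hP' hQ' hfinP' ⟨5, by omega⟩ (by omega) (by omega)
        (s := fun x y : U => s (x : W) y) (hsU U) (hsmU U) (fun x y => hsymm x y) hP'Q' hdefP' hdefQ' hadj𝔩
  -- STEP 2: otherwise every raising operator has rank in `{0, 9, 10}`
  by_contra hne
  have hbad : ∀ B' ∈ 𝔊, Θ * B' = B' → B' * Θ = -B' →
      Module.finrank ℂ (LinearMap.range B') = 0 ∨ Module.finrank ℂ (LinearMap.range B') = 9 ∨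
        Module.finrank ℂ (LinearMap.range B') = 10 := by
    intro B' hB' hΘB' hB'Θ
    have h10 := hle10 B' hΘB'
    by_cases h0 : Module.finrank ℂ (LinearMap.range B') = 0
    · exact Or.inl h0
    by_cases h8 : Module.finrank ℂ (LinearMap.range B') ≤ 8
    · exact absurd (key B' hB' hΘB' hB'Θ (by omega) h8) hne
    omega
  -- STEP 3: the two Levi-pair steps
  have hno10 : ∀ B ∈ 𝔊, Θ * B = B → B * Θ = -B → Module.finrank ℂ (LinearMap.range B) ≠ 10 :=
    fun B hB hΘB hBΘ h10 => UnitaryTenNineteen.no_rank_ten hbr hirr hΘ hΘΘ hP hQ hP10 hQ19 hadd hsymm hPQ hdefP hdefQ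
      hadj hbad hB hΘB hBΘ h10
  have hbad₂ : ∀ B' ∈ 𝔊, Θ * B' = B' → B' * Θ = -B' →
      Module.finrank ℂ (LinearMap.range B') = 0 ∨ Module.finrank ℂ (LinearMap.range B') = 9 := by
    intro B' hB' hΘB' hB'Θ
    have h10 := hno10 B' hB' hΘB' hB'Θ
    rcases hbad B' hB' hΘB' hB'Θ with h | h | h <;> omega
  exact UnitaryTenNineteen.false_of_rank_zero_or_nine hbr hirr hΘ hΘΘ hP hQ hP10 hQ19 hadd hsymm hPQ hdefP hdefQ hadj
    hbad₂

/-- **The mirror core `(19, 10)`** (apply `eq_top_of_smul` to `−Θ`). [cite: Ribet1983, Thm. 3]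
[cite: Gordon1997, Thm. 6.3 (3)] -/
theorem UnitaryTenNineteen.eq_top_of_smul' [FiniteDimensional ℂ W] {𝔊 : Submodule ℂ (Module.End ℂ W)}
    (hbr : ∀ Y ∈ 𝔊, ∀ Z ∈ 𝔊, Y * Z - Z * Y ∈ 𝔊)
    (hirr : ∀ U : Submodule ℂ W, (∀ A ∈ 𝔊, ∀ u ∈ U, A u ∈ U) → U = ⊥ ∨ U = ⊤)
    {Θ : Module.End ℂ W} (hΘ : Θ ∈ 𝔊) (hΘΘ : Θ * Θ = 1)
    {P Q : Submodule ℂ W} (hP : ∀ x, x ∈ P ↔ Θ x = x) (hQ : ∀ x, x ∈ Q ↔ Θ x = -x)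
    (hP19 : Module.finrank ℂ P = 19) (hQ10 : Module.finrank ℂ Q = 10)
    {s : W → W → ℂ} (hadd : ∀ x y z, s (x + y) z = s x z + s y z)
    (hsmul : ∀ (c : ℂ) (x y : W), s (c • x) y = c * s x y) (hsymm : ∀ x y, s y x = starRingEnd ℂ (s x y))
    (hPQ : ∀ p ∈ P, ∀ q ∈ Q, s p q = 0) (hdefP : ∀ p ∈ P, s p p = 0 → p = 0) (hdefQ : ∀ q ∈ Q, s q q = 0 → q = 0)
    (hadj : ∀ X ∈ 𝔊, ∃ Y ∈ 𝔊, ∀ x y, s (X x) y = s x (Y y)) : 𝔊 = ⊤ := by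
  have hnΘ : -Θ ∈ 𝔊 := Submodule.neg_mem _ hΘ
  have hnΘΘ : (-Θ) * (-Θ) = 1 := by rw [neg_mul_neg, hΘΘ]
  exact UnitaryTenNineteen.eq_top_of_smul hbr hirr hnΘ hnΘΘ (P := Q) (Q := P)
    (fun x => by rw [hQ, LinearMap.neg_apply, neg_eq_iff_eq_neg]) (fun x => by rw [hP, LinearMap.neg_apply, neg_inj])
    hQ10 hP19 hadd hsmul hsymm (fun p hp q hq => by rw [hsymm, hPQ q hq p hp, map_zero]) hdefQ hdefP hadj

end HodgeStructure

end Literature.AlgebraicGeometry.Motives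

end
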